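import Literature.MathematicalPhysics.QuantumManyBody.JelliumSmallBoxGeometry
import HarnessLib

/-!
# Lieb–Solovej Lemma 3.3: reduction of the jellium lower bound to one small box

Topic `Literature/MathematicalPhysics/QuantumManyBody` (the charged Bose gas, `JelliumBoseGas.foldyLaw`).
[LiebSolovej2001, Lemma 3.3] ("Reduction to one small box"): the ground-state energy of jellium in
the big box is bounded below by the number of small boxes times the bosonic ground-state energy of
the one-box Hamiltonian `H^n_ℓ` minimised over the particle number, up to the sliding error
`ω N/(2ℓ)` and the boundary-box error `const (L/ℓ)² ρ²ℓ⁵`: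

`E₀ ≥ (1 + L/ℓ)³ · min_{n ≤ N} (inf Spec γH^n_ℓ ∧ 0) - const (L/ℓ)² ρ² ℓ⁵ - ω N/(2ℓ)`.

We assemble it in the tree's vocabulary (units `ħ = 2m = 1`, coupling `q`; `γ = (∫χ²)⁻¹`;
`E^n = boxGroundStateEnergy 1 (qγ) ρ χ_ℓ (ω/ℓ) n ℓ`) from
* the sliding bound [LiebSolovej2001, Lemma 3.2, first display] (`chargedEnergy_toReal_ge_sliding`),
* the kinetic tiling identity (`lintegral_kineticDensity_eq_tiling`),
* the decomposition step [Lemma 3.2, "`(Ψ, H̃Ψ) ≥ inf_n E^n`"] (`sum_boxGroundStateEnergy_mul_mass_le`),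
  here in an `ℝ≥0∞` form uniform in the box position `z` (`decomposition_ennreal`) so that it can be
  integrated over `z ∈ (-ℓ, L)³` by Tonelli,
* the geometry of the three kinds of boxes (`JelliumSmallBoxGeometry.lean`).

Main results: `JelliumBoseGas.chargedEnergy_toReal_ge_boxes` (for a trial state) and
`JelliumBoseGas.chargedGroundStateEnergy_toReal_ge_boxes` (**Lemma 3.3**, for the ground-state
energy).

## References

* [LiebSolovej2001] E. H. Lieb, J. P. Solovej, Commun. Math. Phys. 217 (2001) 127–163, Lemmas
  3.2–3.3 (arXiv:cond-mat/0007425, pp. 8–9).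
-/

noncomputable section

open MeasureTheory Set Filter Real
open scoped ENNReal NNReal Topology

namespace Literature.MathematicalPhysics.QuantumManyBody.JelliumBoseGas

open BoseGas Coulomb

/-- The Yukawa potential in applied form. [folklore] -/
theorem exp_div_norm_eq_yukawa (ν : ℝ) (x : Space) : Real.exp (-(ν * ‖x‖)) / ‖x‖ = yukawa ν x := rfl

/-! ### The decomposition step, uniformly in the box position -/

section PerBox

variable {N : ℕ}

/-- **The decomposition step in `ℝ≥0∞`, uniform in the position of the box**: under the
hypotheses of `sum_boxGroundStateEnergy_mul_mass_le` (with `κ = 1`) for a NORMALISED `Ψ`, if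
`Emin ≤ 0` bounds every `E^n`, `n ≤ N`, from below and `c_N = gρ N M² ‖Y_ν‖₁`, then for every `z`
`c_N + gρ ∫PB_z|Ψ|² ≤ ∫KIN_z + g ∫PP_z|Ψ|² + (c_N - Emin + gρ² ½∬w)` (all terms nonnegative; the
uniform shift `c_N - Emin` replaces the real numbers `E^{|S|}`). [cite: LiebSolovej2001, Lemma 3.2] -/
theorem decomposition_ennreal {g ρ : ℝ} (hg : 0 ≤ g) (hρ : 0 ≤ ρ)
    {θ : Space → ℝ} (hθm : Measurable θ) (hθ : ∀ x, 0 ≤ θ x) {M : ℝ} (hM : ∀ x, θ x ≤ M)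
    {ν : ℝ} (hν : 0 < ν) {ℓ : ℝ} (hℓ : 0 < ℓ) (hθ0 : ∀ x, x ∉ box ℓ → θ x = 0) (z : Space)
    {ψ : Config N → ℂ} (hψ : ContDiff ℝ 1 ψ) (hsymm : IsBoseSymmetric ψ)
    (hnorm : ∫⁻ X, (‖ψ X‖₊ : ℝ≥0∞) ^ 2 = 1) (hkin : ∫⁻ X, kineticDensity ψ X ≠ ⊤)
    (hPP : ∫⁻ X, ENNReal.ofReal (∑ i, ∑ j with i < j,
      θ (X i - z) * yukawa ν (X i - X j) * θ (X j - z)) * (‖ψ X‖₊ : ℝ≥0∞) ^ 2 ≠ ⊤)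
    {Emin : ℝ} (hEmin : ∀ n, n ≤ N → Emin ≤ boxGroundStateEnergy 1 g ρ θ ν n ℓ) (hEmin0 : Emin ≤ 0) :
    ENNReal.ofReal (g * ρ * (N * (M * (M * ∫ y, yukawa ν y)))) +
        ENNReal.ofReal (g * ρ) * ∫⁻ X, ENNReal.ofReal (∑ j, θ (X j - z) * smearedBackground θ ν (X j - z)) *
          (‖ψ X‖₊ : ℝ≥0∞) ^ 2 ≤
      (∫⁻ X, ∑ j, (box ℓ).indicator (fun _ => (1 : ℝ≥0∞)) (X j - z) *
          ∑ k : Fin 3, (‖fderiv ℝ ψ X (Pi.single j (EuclideanSpace.single k (1 : ℝ)))‖₊ : ℝ≥0∞) ^ 2) +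
        ENNReal.ofReal g * (∫⁻ X, ENNReal.ofReal (∑ i, ∑ j with i < j,
          θ (X i - z) * yukawa ν (X i - X j) * θ (X j - z)) * (‖ψ X‖₊ : ℝ≥0∞) ^ 2) +
        ENNReal.ofReal (g * ρ * (N * (M * (M * ∫ y, yukawa ν y))) - Emin +
          g * ρ ^ 2 * boxBackgroundSelfEnergy θ ν) := by
  have hM0 : 0 ≤ M := (hθ 0).trans (hM 0)
  have hIY : 0 ≤ ∫ y, yukawa ν y := integral_nonneg fun y => yukawa_nonneg ν y
  have hbb0 : 0 ≤ boxBackgroundSelfEnergy θ ν := mul_nonneg (by norm_num) (integral_nonneg fun x =>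
    mul_nonneg (hθ x) (smearedBackground_nonneg hθ ν x))
  have hcN : 0 ≤ g * ρ * (N * (M * (M * ∫ y, yukawa ν y))) := by positivity
  have hmass : ∫⁻ X, (‖ψ X‖₊ : ℝ≥0∞) ^ 2 ≠ ⊤ := by rw [hnorm]; exact ENNReal.one_ne_top
  -- the real decomposition inequality
  have hdec := sum_boxGroundStateEnergy_mul_mass_le zero_le_one hg hρ hθm hθ hM hν hℓ hθ0 z hψ hsymm
    hmass hkin hPP
  -- the masses of the pieces sum to one
  have hW : Measurable fun X : Config N => (‖ψ X‖₊ : ℝ≥0∞) ^ 2 := measurable_normSq hψ.continuous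
  have hsum1 : ∑ S : Finset (Fin N),
      (∫⁻ X in {X : Config N | ∀ j, X j - z ∈ box ℓ ↔ j ∈ S}, (‖ψ X‖₊ : ℝ≥0∞) ^ 2).toReal = 1 := by
    rw [← ENNReal.toReal_sum fun S _ => ne_top_of_le_ne_top hmass (setLIntegral_le_lintegral _ _),
      sum_setLIntegral_pieceSet ℓ z hW, hnorm, ENNReal.toReal_one]
  -- lower bound of the left side by `Emin`
  have hleft : Emin ≤ ∑ S : Finset (Fin N), boxGroundStateEnergy 1 g ρ θ ν S.card ℓ *
      (∫⁻ X in {X : Config N | ∀ j, X j - z ∈ box ℓ ↔ j ∈ S}, (‖ψ X‖₊ : ℝ≥0∞) ^ 2).toReal := by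
    calc Emin = ∑ S : Finset (Fin N), Emin *
          (∫⁻ X in {X : Config N | ∀ j, X j - z ∈ box ℓ ↔ j ∈ S}, (‖ψ X‖₊ : ℝ≥0∞) ^ 2).toReal := by
            rw [← Finset.mul_sum, hsum1, mul_one]
      _ ≤ _ := Finset.sum_le_sum fun S _ => mul_le_mul_of_nonneg_right
            (hEmin S.card (S.card_le_univ.trans_eq (Fintype.card_fin N))) ENNReal.toReal_nonneg
  -- finiteness of the three `z`-functionals
  have hKle : (∫⁻ X, ∑ j, (box ℓ).indicator (fun _ => (1 : ℝ≥0∞)) (X j - z) *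
      ∑ k : Fin 3, (‖fderiv ℝ ψ X (Pi.single j (EuclideanSpace.single k (1 : ℝ)))‖₊ : ℝ≥0∞) ^ 2) ≤
      ∫⁻ X, kineticDensity ψ X := by
    refine lintegral_mono fun X => ?_
    unfold kineticDensity
    refine Finset.sum_le_sum fun j _ => ?_
    calc (box ℓ).indicator (fun _ => (1 : ℝ≥0∞)) (X j - z) *
          ∑ k : Fin 3, (‖fderiv ℝ ψ X (Pi.single j (EuclideanSpace.single k (1 : ℝ)))‖₊ : ℝ≥0∞) ^ 2
        ≤ 1 * ∑ k : Fin 3, (‖fderiv ℝ ψ X (Pi.single j (EuclideanSpace.single k (1 : ℝ)))‖₊ : ℝ≥0∞) ^ 2 :=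
          mul_le_mul' (Set.indicator_le_self' (fun _ _ => zero_le_one) _) le_rfl
      _ = _ := one_mul _
  have hKtop := ne_top_of_le_ne_top hkin hKle
  have hPBle : ∫⁻ X, ENNReal.ofReal (∑ j, θ (X j - z) * smearedBackground θ ν (X j - z)) *
      (‖ψ X‖₊ : ℝ≥0∞) ^ 2 ≤ ENNReal.ofReal (N * (M * (M * ∫ y, yukawa ν y))) := by
    calc _ ≤ ∫⁻ X, ENNReal.ofReal (N * (M * (M * ∫ y, yukawa ν y))) * (‖ψ X‖₊ : ℝ≥0∞) ^ 2 :=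
          lintegral_mono fun X => mul_le_mul' (ENNReal.ofReal_le_ofReal
            (boxOneBody_le hθ hM hν (fun j => X j - z))) le_rfl
      _ = _ := by rw [lintegral_const_mul' _ _ ENNReal.ofReal_ne_top, hnorm, mul_one]
  have hPBtop := ne_top_of_le_ne_top ENNReal.ofReal_ne_top hPBle
  -- the real inequality, rearranged with nonnegative terms
  rw [hnorm, ENNReal.toReal_one, mul_one, one_mul] at hdec
  have hreal : g * ρ * (N * (M * (M * ∫ y, yukawa ν y))) + g * ρ *
      (∫⁻ X, ENNReal.ofReal (∑ j, θ (X j - z) * smearedBackground θ ν (X j - z)) *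
        (‖ψ X‖₊ : ℝ≥0∞) ^ 2).toReal ≤
      (∫⁻ X, ∑ j, (box ℓ).indicator (fun _ => (1 : ℝ≥0∞)) (X j - z) *
        ∑ k : Fin 3, (‖fderiv ℝ ψ X (Pi.single j (EuclideanSpace.single k (1 : ℝ)))‖₊ : ℝ≥0∞) ^ 2).toReal +
      g * (∫⁻ X, ENNReal.ofReal (∑ i, ∑ j with i < j,
          θ (X i - z) * yukawa ν (X i - X j) * θ (X j - z)) * (‖ψ X‖₊ : ℝ≥0∞) ^ 2).toReal +
      (g * ρ * (N * (M * (M * ∫ y, yukawa ν y))) - Emin + g * ρ ^ 2 * boxBackgroundSelfEnergy θ ν) := by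
    linarith
  -- back to `ℝ≥0∞`
  have h2 : 0 ≤ g * ρ * (N * (M * (M * ∫ y, yukawa ν y))) - Emin + g * ρ ^ 2 * boxBackgroundSelfEnergy θ ν := by
    nlinarith [mul_nonneg (mul_nonneg hg (sq_nonneg ρ)) hbb0]
  rw [← ENNReal.ofReal_toReal hPBtop, ← ENNReal.ofReal_toReal hKtop, ← ENNReal.ofReal_toReal hPP,
    ← ENNReal.ofReal_mul (mul_nonneg hg hρ), ← ENNReal.ofReal_mul hg,
    ← ENNReal.ofReal_add hcN (mul_nonneg (mul_nonneg hg hρ) ENNReal.toReal_nonneg),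
    ← ENNReal.ofReal_add ENNReal.toReal_nonneg (mul_nonneg hg ENNReal.toReal_nonneg),
    ← ENNReal.ofReal_add (add_nonneg ENNReal.toReal_nonneg (mul_nonneg hg ENNReal.toReal_nonneg)) h2]
  exact ENNReal.ofReal_le_ofReal hreal

end PerBox

/-! ### The `z`-functionals: measurability, finiteness, vanishing off the relevant region -/

section ZFunctionals

variable {N : ℕ}

/-- Measurability in `z` of the localized kinetic energy `∫ ∑ⱼ 𝟙_{Λ_ℓ}(xⱼ - z)|∇ⱼψ|²`. [folklore] -/
theorem measurable_kinBox {ψ : Config N → ℂ} (hψ : ContDiff ℝ 1 ψ) (ℓ : ℝ) :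
    Measurable fun z : Space => ∫⁻ X : Config N, ∑ j, (box ℓ).indicator (fun _ => (1 : ℝ≥0∞)) (X j - z) *
          ∑ k : Fin 3, (‖fderiv ℝ ψ X (Pi.single j (EuclideanSpace.single k (1 : ℝ)))‖₊ : ℝ≥0∞) ^ 2 := by
  have hind : Measurable ((box ℓ).indicator fun _ : Space => (1 : ℝ≥0∞)) :=
    measurable_const.indicator (measurableSet_box ℓ)
  have hF : Measurable fun q : Config N × Space => ∑ j, (box ℓ).indicator (fun _ => (1 : ℝ≥0∞)) (q.1 j - q.2) *
      ∑ k : Fin 3, (‖fderiv ℝ ψ q.1 (Pi.single j (EuclideanSpace.single k (1 : ℝ)))‖₊ : ℝ≥0∞) ^ 2 := by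
    refine Finset.measurable_sum _ fun j _ => ?_
    have hsub : Measurable fun q : Config N × Space => q.1 j - q.2 :=
      ((measurable_config_apply j).comp measurable_fst).sub measurable_snd
    exact (hind.comp hsub).mul ((measurable_kineticDensityAt hψ j).comp measurable_fst)
  exact hF.lintegral_prod_left'

/-- Measurability in `z` of the localized pair energy `∫ PP_z |ψ|²`. [folklore] -/
theorem measurable_ppBox {θ : Space → ℝ} (hθm : Measurable θ) (ν : ℝ) {ψ : Config N → ℂ}
    (hψ : Continuous ψ) :
    Measurable fun z : Space => ∫⁻ X : Config N, ENNReal.ofReal (∑ i, ∑ j with i < j, θ (X i - z) * yukawa ν (X i - X j) * θ (X j - z)) * (‖ψ X‖₊ : ℝ≥0∞) ^ 2 := by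
  have hW : Measurable fun X : Config N => (‖ψ X‖₊ : ℝ≥0∞) ^ 2 := measurable_normSq hψ
  have hm1 : ∀ i : Fin N, Measurable fun q : Config N × Space => q.1 i - q.2 := fun i =>
    ((measurable_config_apply i).comp measurable_fst).sub measurable_snd
  have hm2 : ∀ i j : Fin N, Measurable fun q : Config N × Space => q.1 i - q.1 j := fun i j =>
    ((measurable_config_apply i).comp measurable_fst).sub ((measurable_config_apply j).comp measurable_fst)
  have hF : Measurable fun q : Config N × Space => ENNReal.ofReal (∑ i, ∑ j with i < j,
      θ (q.1 i - q.2) * yukawa ν (q.1 i - q.1 j) * θ (q.1 j - q.2)) * (‖ψ q.1‖₊ : ℝ≥0∞) ^ 2 :=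
    (Finset.measurable_sum _ fun i _ => Finset.measurable_sum _ fun j _ =>
      ((hθm.comp (hm1 i)).mul ((measurable_yukawa ν).comp (hm2 i j))).mul
        (hθm.comp (hm1 j))).ennreal_ofReal.mul (hW.comp measurable_fst)
  exact hF.lintegral_prod_left'

/-- Measurability in `z` of the localized (full) background energy `∫ PB_z |ψ|²`. [folklore] -/
theorem measurable_pbBox {θ : Space → ℝ} (hθm : Measurable θ) (ν : ℝ) {ψ : Config N → ℂ}
    (hψ : Continuous ψ) :
    Measurable fun z : Space => ∫⁻ X : Config N, ENNReal.ofReal (∑ j, θ (X j - z) * smearedBackground θ ν (X j - z)) * (‖ψ X‖₊ : ℝ≥0∞) ^ 2 := by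
  have hW : Measurable fun X : Config N => (‖ψ X‖₊ : ℝ≥0∞) ^ 2 := measurable_normSq hψ
  have hm1 : ∀ i : Fin N, Measurable fun q : Config N × Space => q.1 i - q.2 := fun i =>
    ((measurable_config_apply i).comp measurable_fst).sub measurable_snd
  have hF : Measurable fun q : Config N × Space => ENNReal.ofReal (∑ j,
      θ (q.1 j - q.2) * smearedBackground θ ν (q.1 j - q.2)) * (‖ψ q.1‖₊ : ℝ≥0∞) ^ 2 :=
    (Finset.measurable_sum _ fun j _ => (hθm.comp (hm1 j)).mul
      ((measurable_smearedBackground hθm ν).comp (hm1 j))).ennreal_ofReal.mul (hW.comp measurable_fst)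
  exact hF.lintegral_prod_left'

/-- The localized pair energy is finite for a bounded `ψ` supported in the big box: it is at most
`M² ∫ ∑_{i<j}|xᵢ - xⱼ|⁻¹|ψ|²`. [folklore] -/
theorem ppBox_ne_top {θ : Space → ℝ} (hθ : ∀ x, 0 ≤ θ x) {M : ℝ} (hM : ∀ x, θ x ≤ M) {ν : ℝ}
    (hν : 0 ≤ ν) {L : ℝ} (Ψ : TrialState N L) (z : Space) :
    ∫⁻ X : Config N, ENNReal.ofReal (∑ i, ∑ j with i < j,
      θ (X i - z) * yukawa ν (X i - X j) * θ (X j - z)) * (‖Ψ.ψ X‖₊ : ℝ≥0∞) ^ 2 ≠ ⊤ := by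
  have hpt : ∀ X : Config N, ENNReal.ofReal (∑ i, ∑ j with i < j,
      θ (X i - z) * yukawa ν (X i - X j) * θ (X j - z)) ≤
      ENNReal.ofReal (M ^ 2) * ∑ i, ∑ j with i < j, ENNReal.ofReal ‖X i - X j‖⁻¹ := by
    intro X
    have h := boxPair_le hθ hM hν (fun i => X i - z)
    simp only [boxPair, sub_sub_sub_cancel_right] at h
    refine (ENNReal.ofReal_le_ofReal h).trans (le_of_eq ?_)
    rw [ENNReal.ofReal_mul (sq_nonneg M), ENNReal.ofReal_sum_of_nonneg fun i _ =>
      Finset.sum_nonneg fun j _ => inv_nonneg.2 (norm_nonneg _)]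
    congr 1
    exact Finset.sum_congr rfl fun i _ => ENNReal.ofReal_sum_of_nonneg fun j _ =>
      inv_nonneg.2 (norm_nonneg _)
  refine ne_top_of_le_ne_top ?_ (lintegral_mono fun X => mul_le_mul' (hpt X) le_rfl)
  simp_rw [mul_assoc]
  rw [lintegral_const_mul' _ _ ENNReal.ofReal_ne_top]
  exact ENNReal.mul_ne_top ENNReal.ofReal_ne_top (lintegral_sum_inv_norm_sub_mul_ne_top Ψ)

/-- The topological support of a wave function vanishing off the open box lies in the closed box.
[folklore] -/
theorem tsupport_subset_closedBoxN {ψ : Config N → ℂ} {L : ℝ} (hψ0 : ∀ X, X ∉ boxN N L → ψ X = 0) :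
    tsupport ψ ⊆ {X : Config N | ∀ j k, X j k ∈ Set.Icc 0 L} := by
  have hcl : IsClosed {X : Config N | ∀ j k, X j k ∈ Set.Icc 0 L} := by
    have h : {X : Config N | ∀ j k, X j k ∈ Set.Icc 0 L} = ⋂ j, ⋂ k, (fun X : Config N => X j k) ⁻¹' Set.Icc 0 L := by
      ext X; simp
    rw [h]
    exact isClosed_iInter fun j => isClosed_iInter fun k => isClosed_Icc.preimage (by fun_prop)
  refine closure_minimal (fun X hX => ?_) hcl
  have hXb : X ∈ boxN N L := by
    by_contra h
    exact hX (hψ0 X h)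
  exact fun j k => Set.Ioo_subset_Icc_self (hXb j k)

/-- **Boxes of the first kind carry no kinetic energy**: if `z ∉ (-ℓ, L)³` then the localized kinetic
integrand vanishes identically for a `C¹` wave function supported in `Λ_L^N`.
[cite: LiebSolovej2001, p. 9] -/
theorem kinBox_integrand_eq_zero {ψ : Config N → ℂ} {L ℓ : ℝ} (hψ0 : ∀ X, X ∉ boxN N L → ψ X = 0)
    {z : Space} (hz : ¬ ∀ k, z k ∈ Set.Ioo (-ℓ) L) (X : Config N) : ∑ j, (box ℓ).indicator (fun _ => (1 : ℝ≥0∞)) (X j - z) *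
          ∑ k : Fin 3, (‖fderiv ℝ ψ X (Pi.single j (EuclideanSpace.single k (1 : ℝ)))‖₊ : ℝ≥0∞) ^ 2 = 0 := by
  refine Finset.sum_eq_zero fun j _ => ?_
  by_cases hX : X ∈ tsupport ψ
  · have hXc := tsupport_subset_closedBoxN hψ0 hX
    have hind : (box ℓ).indicator (fun _ => (1 : ℝ≥0∞)) (X j - z) = 0 := by
      refine indicator_of_notMem (fun hmem => hz fun k => ?_) _
      have h1 := hXc j k
      have h2 := hmem k
      simp only [PiLp.sub_apply, Set.mem_Ioo, Set.mem_Icc] at h1 h2 ⊢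
      constructor <;> linarith [h1.1, h1.2, h2.1, h2.2]
    rw [hind, zero_mul]
  · have hd : fderiv ℝ ψ X = 0 := fderiv_of_notMem_tsupport ℝ hX
    simp [hd]

/-- **Boxes of the first kind carry no pair energy**: if `z ∉ (-ℓ, L)³`, `θ = 0` off `Λ_ℓ` and
`ψ = 0` off `Λ_L^N`, the localized pair integrand vanishes. [cite: LiebSolovej2001, p. 9] -/
theorem ppBox_integrand_eq_zero {θ : Space → ℝ} {ℓ : ℝ} (hθ0 : ∀ x, x ∉ box ℓ → θ x = 0) (ν : ℝ)
    {ψ : Config N → ℂ} {L : ℝ} (hψ0 : ∀ X, X ∉ boxN N L → ψ X = 0) {z : Space}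
    (hz : ¬ ∀ k, z k ∈ Set.Ioo (-ℓ) L) (X : Config N) :
    ENNReal.ofReal (∑ i, ∑ j with i < j, θ (X i - z) * yukawa ν (X i - X j) * θ (X j - z)) * (‖ψ X‖₊ : ℝ≥0∞) ^ 2 = 0 := by
  by_cases hXb : X ∈ boxN N L
  · have hθX : ∀ i, θ (X i - z) = 0 := fun i =>
      hθ0 _ fun h => hz (mem_Ioo_of_sub_mem_box (hXb i) h)
    simp [hθX]
  · rw [hψ0 X hXb]
    simp

/-- **Boxes of the first kind see no background**: if `z ∉ (-ℓ, L)³` and `θ = 0` off `Λ_ℓ`, the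
background of `Λ_L` localized to the box vanishes. [cite: LiebSolovej2001, p. 9] -/
theorem pbBoxΛ_eq_zero {θ : Space → ℝ} {ℓ : ℝ} (hθ0 : ∀ x, x ∉ box ℓ → θ x = 0) (ν : ℝ) {L : ℝ}
    {z : Space} (hz : ¬ ∀ k, z k ∈ Set.Ioo (-ℓ) L) (X : Config N) : ∑ i, ∫ y in box L, θ (X i - z) * yukawa ν (X i - y) * θ (y - z) = 0 := by
  refine Finset.sum_eq_zero fun i _ => setIntegral_eq_zero_of_forall_eq_zero fun y hy => ?_
  rw [hθ0 _ (fun h => hz (mem_Ioo_of_sub_mem_box hy h)), mul_zero]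

end ZFunctionals

/-! ### The final arithmetic -/

/-- The bookkeeping of [LiebSolovej2001, Lemma 3.3] as an inequality between real numbers: the
sliding bound (`hslide`), the kinetic tiling (`hT`), the scale relation `γ_ℓ = ℓ⁻³γ` (`hA`), the
`z`-integrated decomposition (`hreal`), `PB_Λ ≤ PB` (`hPB`), `BB_Λ = 2·(½∬w)` on interior boxes
(`hIBB`) and `½∬w ≤ B₅` (`hB5`) combine to the lower bound. [cite: LiebSolovej2001, Lemma 3.3] -/
theorem reduction_arith {q ρ γ ℓ3 A Tk IK IPP IPB JPB IBB bbE B5 Emin V Vint cN err E : ℝ}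
    (hq : 0 ≤ q) (hρ : 0 ≤ ρ) (hγ : 0 ≤ γ) (hℓ3 : 0 ≤ ℓ3) (hVd : 0 ≤ V - Vint)
    (hA : A = ℓ3 * γ) (hT : Tk = ℓ3 * IK)
    (hslide : Tk + q * (A * IPP - ρ * (A * IPB) + ρ ^ 2 / 2 * (A * IBB)) - err ≤ E)
    (hreal : cN * V + q * γ * ρ * JPB ≤ 1 * IK + q * γ * IPP + (cN - Emin + q * γ * ρ ^ 2 * bbE) * V)
    (hPB : IPB ≤ JPB) (hIBB : 2 * bbE * Vint ≤ IBB) (hB5 : bbE ≤ B5) :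
    ℓ3 * V * Emin - ℓ3 * (q * γ * ρ ^ 2 * B5) * (V - Vint) - err ≤ E := by
  subst hA hT
  have hstar : Emin * V ≤ IK + q * γ * IPP - q * γ * ρ * JPB + q * γ * ρ ^ 2 * bbE * V := by linarith
  have h1 := mul_le_mul_of_nonneg_left hstar hℓ3
  have h2 := mul_le_mul_of_nonneg_left hPB (by positivity : (0 : ℝ) ≤ q * ρ * ℓ3 * γ)
  have h3 := mul_le_mul_of_nonneg_left hIBB (by positivity : (0 : ℝ) ≤ q * (ρ ^ 2 / 2) * ℓ3 * γ)
  have h4 := mul_le_mul_of_nonneg_left hB5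
    (mul_nonneg (by positivity : (0 : ℝ) ≤ ℓ3 * (q * γ * ρ ^ 2)) hVd)
  linarith

/-! ### Lemma 3.3 -/

section Reduction

variable {χ : Space → ℝ}

/-- **[LiebSolovej2001, Lemma 3.3] (reduction to one small box), for a trial state.** Let
`χ ∈ C_c^∞(ℝ³)` with `0 ≤ χ ≤ M`, `χ = 0` off the unit box `Λ_1` and `∫χ² ≠ 0`; `γ = (∫χ²)⁻¹`,
`ω ≥ ω₀(χ)` (the Conlon–Lieb–Yau threshold), `0 < ℓ ≤ L`, `ρ ≥ 0`, `q > 0`. Let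
`E^n = inf Spec` of the one-box Hamiltonian with kinetic coefficient `1`, coupling `qγ`, cutoff
`χ_ℓ = χ(·/ℓ)`, Yukawa parameter `ω/ℓ` (`boxGroundStateEnergy 1 (qγ) ρ χ_ℓ (ω/ℓ) n ℓ`), and let
`Emin ≤ 0` be a lower bound of `E^n` for all `n ≤ N`. Then for every `N`-boson trial state `Ψ` in
`Λ_L`,
`⟨Ψ, HΨ⟩ ≥ ℓ⁻³(L+ℓ)³ Emin - ℓ⁻³ qγρ² (3πM²ℓ⁵) ((L+ℓ)³ - (L-ℓ)³) - q ω N/(2ℓ)`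
— `(1 + L/ℓ)³` boxes each contributing at least `Emin`, the boundary boxes (volume of positions
`(L+ℓ)³ - (L-ℓ)³ ≤ const L²ℓ`) each losing at most the background self-energy `½ρ²qγ∬w ≤ 3πqγρ²M²ℓ⁵`,
and the sliding error. Here `⟨Ψ,HΨ⟩ = (chargedEnergy 0 q ρ Ψ).toReal - jelliumEnergyShift q ρ N L`.
[cite: LiebSolovej2001, Lemma 3.3] -/
theorem chargedEnergy_toReal_ge_boxes (hχ : ContDiff ℝ (⊤ : ℕ∞) χ) (hsupp : HasCompactSupport χ)
    (hχ0 : (∫ u, χ u ^ 2) ≠ 0) (hχnn : ∀ x, 0 ≤ χ x) {M : ℝ} (hχM : ∀ x, χ x ≤ M)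
    (hχbox : ∀ x, x ∉ box 1 → χ x = 0) :
    ∃ ω₀ : ℝ, 0 < ω₀ ∧ ∀ ω : ℝ, ω₀ ≤ ω → ∀ ℓ : ℝ, 0 < ℓ → ∀ ρ : ℝ, 0 ≤ ρ → ∀ L : ℝ, ℓ ≤ L →
      ∀ {q : ℝ}, 0 < q → ∀ {N : ℕ} (Ψ : TrialState N L) {Emin : ℝ},
        (∀ n, n ≤ N → Emin ≤
          boxGroundStateEnergy 1 (q * (∫ u, χ u ^ 2)⁻¹) ρ (fun x => χ (ℓ⁻¹ • x)) (ω / ℓ) n ℓ) →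
        Emin ≤ 0 →
        (ℓ ^ 3)⁻¹ * (L + ℓ) ^ 3 * Emin -
            (ℓ ^ 3)⁻¹ * (q * (∫ u, χ u ^ 2)⁻¹ * ρ ^ 2 * (3 * π * M ^ 2 * ℓ ^ 5)) * ((L + ℓ) ^ 3 - (L - ℓ) ^ 3) -
            q * (1 / 2 * (ω / ℓ) * N) ≤
          (chargedEnergy 0 q ρ Ψ).toReal - jelliumEnergyShift q ρ N L := by
  obtain ⟨ω₀, hω₀, H⟩ := chargedEnergy_toReal_ge_sliding hχ hsupp hχ0 hχnn
  refine ⟨ω₀, hω₀, fun ω hω ℓ hℓ ρ hρ L hℓL q hq N Ψ Emin hEmin hEmin0 => ?_⟩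
  obtain ⟨hIPP, hIPB, hslide⟩ := H ω hω ℓ hℓ ρ hρ L hq Ψ
  -- positivity of the data
  have hL : 0 < L := hℓ.trans_le hℓL
  have hν : 0 < ω / ℓ := div_pos (hω₀.trans_le hω) hℓ
  have hγpos : 0 < (∫ u, χ u ^ 2)⁻¹ :=
    inv_pos.2 (lt_of_le_of_ne (integral_nonneg fun u => sq_nonneg _) (Ne.symm hχ0))
  have hγ0 : 0 ≤ (∫ u, χ u ^ 2)⁻¹ := hγpos.le
  have hg : 0 ≤ q * (∫ u, χ u ^ 2)⁻¹ := mul_nonneg hq.le hγ0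
  have hℓ3 : 0 < (ℓ ^ 3)⁻¹ := by positivity
  have hγℓ : (∫ u, χ (ℓ⁻¹ • u) ^ 2)⁻¹ = (ℓ ^ 3)⁻¹ * (∫ u, χ u ^ 2)⁻¹ := by
    rw [integral_sq_comp_inv_smul χ hℓ, mul_inv]
  -- the cutoff at scale `ℓ`
  have hθc : Continuous fun x : Space => χ (ℓ⁻¹ • x) := hχ.continuous.comp (continuous_const_smul _)
  have hθsupp : HasCompactSupport fun x : Space => χ (ℓ⁻¹ • x) := hsupp.comp_smul (inv_ne_zero hℓ.ne')
  have hθm : Measurable fun x : Space => χ (ℓ⁻¹ • x) := hθc.measurable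
  have hθnn : ∀ x : Space, 0 ≤ χ (ℓ⁻¹ • x) := fun x => hχnn _
  have hθM : ∀ x : Space, χ (ℓ⁻¹ • x) ≤ M := fun x => hχM _
  have hθ0 : ∀ x : Space, x ∉ box ℓ → χ (ℓ⁻¹ • x) = 0 := fun x hx =>
    cutoff_eq_zero_of_not_mem_box hχbox hℓ x hx
  have hM0 : 0 ≤ M := (hθnn 0).trans (hθM 0)
  have hY0 : ∀ x : Space, 0 ≤ Real.exp (-(ω / ℓ * ‖x‖)) / ‖x‖ := fun x =>
    div_nonneg (Real.exp_pos _).le (norm_nonneg _)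
  have hIY : 0 ≤ ∫ y, yukawa (ω / ℓ) y := integral_nonneg fun y => yukawa_nonneg _ y
  have hbb0 : 0 ≤ boxBackgroundSelfEnergy (fun x => χ (ℓ⁻¹ • x)) (ω / ℓ) :=
    mul_nonneg (by norm_num) (integral_nonneg fun x => mul_nonneg (hθnn x) (smearedBackground_nonneg hθnn _ x))
  have hbbE : boxBackgroundSelfEnergy (fun x => χ (ℓ⁻¹ • x)) (ω / ℓ) ≤ 3 * π * M ^ 2 * ℓ ^ 5 :=
    boxBackgroundSelfEnergy_le hθnn hθM hℓ.le hθ0 hν.le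
  -- the trial state
  have hψ : ContDiff ℝ 1 Ψ.ψ := Ψ.contDiff
  have hsymm : IsBoseSymmetric Ψ.ψ := Ψ.symm
  have hnorm : ∫⁻ X, (‖Ψ.ψ X‖₊ : ℝ≥0∞) ^ 2 = 1 := Ψ.norm_eq
  have hkin : ∫⁻ X, kineticDensity Ψ.ψ X ≠ ⊤ := Ψ.lintegral_kineticDensity_lt_top.ne
  -- the per-box inequality, uniformly in `z` (`yukawa ν x` is by definition `e^{-ν|x|}/|x|`)
  have hz : ∀ z : Space,
      ENNReal.ofReal (q * (∫ u, χ u ^ 2)⁻¹ * ρ * (N * (M * (M * ∫ y, yukawa (ω / ℓ) y)))) +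
          ENNReal.ofReal (q * (∫ u, χ u ^ 2)⁻¹ * ρ) * ∫⁻ X, ENNReal.ofReal (∑ j, χ (ℓ⁻¹ • (X j - z)) * smearedBackground (fun x => χ (ℓ⁻¹ • x)) (ω / ℓ) (X j - z)) * (‖Ψ.ψ X‖₊ : ℝ≥0∞) ^ 2 ≤
        (∫⁻ X, ∑ j, (box ℓ).indicator (fun _ => (1 : ℝ≥0∞)) (X j - z) *
            ∑ k : Fin 3, (‖fderiv ℝ Ψ.ψ X (Pi.single j (EuclideanSpace.single k (1 : ℝ)))‖₊ : ℝ≥0∞) ^ 2) +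
          ENNReal.ofReal (q * (∫ u, χ u ^ 2)⁻¹) * (∫⁻ X, ENNReal.ofReal (∑ i, ∑ j with i < j, χ (ℓ⁻¹ • (X i - z)) * (Real.exp (-(ω / ℓ * ‖X i - X j‖)) / ‖X i - X j‖) * χ (ℓ⁻¹ • (X j - z))) * (‖Ψ.ψ X‖₊ : ℝ≥0∞) ^ 2) +
          ENNReal.ofReal (q * (∫ u, χ u ^ 2)⁻¹ * ρ * (N * (M * (M * ∫ y, yukawa (ω / ℓ) y))) - Emin +
              q * (∫ u, χ u ^ 2)⁻¹ * ρ ^ 2 * boxBackgroundSelfEnergy (fun x => χ (ℓ⁻¹ • x)) (ω / ℓ)) := fun z =>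
    decomposition_ennreal hg hρ hθm hθnn hθM hν hℓ hθ0 z hψ hsymm hnorm hkin
      (ppBox_ne_top hθnn hθM hν.le Ψ z) hEmin hEmin0
  -- integrate over the positions `z ∈ (-ℓ, L)³`
  have hZm : MeasurableSet {z : Space | ∀ k, z k ∈ Set.Ioo (-ℓ) L} := measurableSet_zRegion L ℓ
  have hVZ : volume {z : Space | ∀ k, z k ∈ Set.Ioo (-ℓ) L} = ENNReal.ofReal (L + ℓ) ^ 3 := volume_zRegion L ℓ
  have hVZtop : volume {z : Space | ∀ k, z k ∈ Set.Ioo (-ℓ) L} ≠ ⊤ := by rw [hVZ]; exact ENNReal.pow_ne_top ENNReal.ofReal_ne_top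
  have hVZr : (volume {z : Space | ∀ k, z k ∈ Set.Ioo (-ℓ) L}).toReal = (L + ℓ) ^ 3 := by
    rw [hVZ, ENNReal.toReal_pow, ENNReal.toReal_ofReal (by linarith)]
  have hint := setLIntegral_mono' (μ := volume) hZm fun z _ => hz z
  have hmc1 : Measurable fun _ : Space => ENNReal.ofReal (q * (∫ u, χ u ^ 2)⁻¹ * ρ * (N * (M * (M * ∫ y, yukawa (ω / ℓ) y)))) := measurable_const
  have hmc2 : Measurable fun _ : Space => ENNReal.ofReal (q * (∫ u, χ u ^ 2)⁻¹ * ρ * (N * (M * (M * ∫ y, yukawa (ω / ℓ) y))) - Emin +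
              q * (∫ u, χ u ^ 2)⁻¹ * ρ ^ 2 * boxBackgroundSelfEnergy (fun x => χ (ℓ⁻¹ • x)) (ω / ℓ)) := measurable_const
  have hmK : Measurable fun z : Space => ∫⁻ X, ∑ j, (box ℓ).indicator (fun _ => (1 : ℝ≥0∞)) (X j - z) *
            ∑ k : Fin 3, (‖fderiv ℝ Ψ.ψ X (Pi.single j (EuclideanSpace.single k (1 : ℝ)))‖₊ : ℝ≥0∞) ^ 2 := measurable_kinBox hψ ℓ
  rw [lintegral_add_left hmc1, setLIntegral_const, lintegral_const_mul' _ _ ENNReal.ofReal_ne_top,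
    lintegral_add_right _ hmc2, setLIntegral_const, lintegral_add_left hmK,
    lintegral_const_mul' _ _ ENNReal.ofReal_ne_top] at hint
  -- boxes of the first kind contribute nothing: extend the `z`-integrals to all of `ℝ³`
  have hKZ : ∫⁻ z in {z : Space | ∀ k, z k ∈ Set.Ioo (-ℓ) L}, ∫⁻ X, ∑ j, (box ℓ).indicator (fun _ => (1 : ℝ≥0∞)) (X j - z) *
            ∑ k : Fin 3, (‖fderiv ℝ Ψ.ψ X (Pi.single j (EuclideanSpace.single k (1 : ℝ)))‖₊ : ℝ≥0∞) ^ 2 = ∫⁻ z, ∫⁻ X, ∑ j, (box ℓ).indicator (fun _ => (1 : ℝ≥0∞)) (X j - z) *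
            ∑ k : Fin 3, (‖fderiv ℝ Ψ.ψ X (Pi.single j (EuclideanSpace.single k (1 : ℝ)))‖₊ : ℝ≥0∞) ^ 2 := by
    refine setLIntegral_eq_of_support_subset fun z hzK => ?_
    by_contra hzZ
    refine hzK ?_
    show (∫⁻ X, ∑ j, (box ℓ).indicator (fun _ => (1 : ℝ≥0∞)) (X j - z) *
            ∑ k : Fin 3, (‖fderiv ℝ Ψ.ψ X (Pi.single j (EuclideanSpace.single k (1 : ℝ)))‖₊ : ℝ≥0∞) ^ 2) = 0
    rw [lintegral_congr fun X => kinBox_integrand_eq_zero Ψ.eq_zero hzZ X, lintegral_zero]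
  have hPZ : ∫⁻ z in {z : Space | ∀ k, z k ∈ Set.Ioo (-ℓ) L}, ∫⁻ X, ENNReal.ofReal (∑ i, ∑ j with i < j, χ (ℓ⁻¹ • (X i - z)) * (Real.exp (-(ω / ℓ * ‖X i - X j‖)) / ‖X i - X j‖) * χ (ℓ⁻¹ • (X j - z))) * (‖Ψ.ψ X‖₊ : ℝ≥0∞) ^ 2 =
      ∫⁻ z, ∫⁻ X, ENNReal.ofReal (∑ i, ∑ j with i < j, χ (ℓ⁻¹ • (X i - z)) * (Real.exp (-(ω / ℓ * ‖X i - X j‖)) / ‖X i - X j‖) * χ (ℓ⁻¹ • (X j - z))) * (‖Ψ.ψ X‖₊ : ℝ≥0∞) ^ 2 := by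
    refine setLIntegral_eq_of_support_subset fun z hzP => ?_
    by_contra hzZ
    refine hzP ?_
    show (∫⁻ X, ENNReal.ofReal (∑ i, ∑ j with i < j, χ (ℓ⁻¹ • (X i - z)) * yukawa (ω / ℓ) (X i - X j) * χ (ℓ⁻¹ • (X j - z))) * (‖Ψ.ψ X‖₊ : ℝ≥0∞) ^ 2) = 0
    rw [lintegral_congr fun X => ppBox_integrand_eq_zero hθ0 (ω / ℓ) Ψ.eq_zero hzZ X, lintegral_zero]
  -- the background of `Λ_L` is at most the full background, and lives on `Z`
  have hPBΛle : ∫⁻ z, ∫⁻ X, ENNReal.ofReal (∑ i, ∫ y in box L, χ (ℓ⁻¹ • (X i - z)) * (Real.exp (-(ω / ℓ * ‖X i - y‖)) / ‖X i - y‖) * χ (ℓ⁻¹ • (y - z))) * (‖Ψ.ψ X‖₊ : ℝ≥0∞) ^ 2 ≤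
      ∫⁻ z in {z : Space | ∀ k, z k ∈ Set.Ioo (-ℓ) L}, ∫⁻ X, ENNReal.ofReal (∑ j, χ (ℓ⁻¹ • (X j - z)) * smearedBackground (fun x => χ (ℓ⁻¹ • x)) (ω / ℓ) (X j - z)) * (‖Ψ.ψ X‖₊ : ℝ≥0∞) ^ 2 := by
    rw [← setLIntegral_eq_of_support_subset (s := {z : Space | ∀ k, z k ∈ Set.Ioo (-ℓ) L}) (fun z hzB => ?_)]
    · refine lintegral_mono fun z => lintegral_mono fun X => mul_le_mul' (ENNReal.ofReal_le_ofReal ?_) le_rfl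
      exact sum_setIntegral_pb_le_boxOneBody hθm hθnn hθM hν L X z
    · by_contra hzZ
      refine hzB ?_
      show (∫⁻ X, ENNReal.ofReal (∑ i, ∫ y in box L, χ (ℓ⁻¹ • (X i - z)) * yukawa (ω / ℓ) (X i - y) * χ (ℓ⁻¹ • (y - z))) * (‖Ψ.ψ X‖₊ : ℝ≥0∞) ^ 2) = 0
      rw [lintegral_congr fun X => by rw [pbBoxΛ_eq_zero hθ0 (ω / ℓ) hzZ X, ENNReal.ofReal_zero, zero_mul],
        lintegral_zero]
  rw [hKZ, hPZ] at hint
  -- finiteness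
  have hPBFtop : ∫⁻ z in {z : Space | ∀ k, z k ∈ Set.Ioo (-ℓ) L}, ∫⁻ X, ENNReal.ofReal (∑ j, χ (ℓ⁻¹ • (X j - z)) * smearedBackground (fun x => χ (ℓ⁻¹ • x)) (ω / ℓ) (X j - z)) * (‖Ψ.ψ X‖₊ : ℝ≥0∞) ^ 2 ≠ ⊤ := by
    have hb : ∀ z, (∫⁻ X, ENNReal.ofReal (∑ j, χ (ℓ⁻¹ • (X j - z)) * smearedBackground (fun x => χ (ℓ⁻¹ • x)) (ω / ℓ) (X j - z)) * (‖Ψ.ψ X‖₊ : ℝ≥0∞) ^ 2) ≤ ENNReal.ofReal (N * (M * (M * ∫ y, yukawa (ω / ℓ) y))) := by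
      intro z
      calc _ ≤ ∫⁻ X, ENNReal.ofReal (N * (M * (M * ∫ y, yukawa (ω / ℓ) y))) * (‖Ψ.ψ X‖₊ : ℝ≥0∞) ^ 2 :=
            lintegral_mono fun X => mul_le_mul' (ENNReal.ofReal_le_ofReal
              (boxOneBody_le hθnn hθM hν (fun j => X j - z))) le_rfl
        _ = _ := by rw [lintegral_const_mul' _ _ ENNReal.ofReal_ne_top, hnorm, mul_one]
    refine ne_top_of_le_ne_top ?_ (setLIntegral_mono' (μ := volume) hZm fun z _ => hb z)
    rw [setLIntegral_const]
    exact ENNReal.mul_ne_top ENNReal.ofReal_ne_top hVZtop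
  -- the kinetic tiling identity `∫|∇Ψ|² = ℓ⁻³ ∫dz KIN_z`
  have hkj : ∀ (z : Space) (j : Fin N), Measurable fun X : Config N =>
      (box ℓ).indicator (fun _ => (1 : ℝ≥0∞)) (X j - z) *
        ∑ k : Fin 3, (‖fderiv ℝ Ψ.ψ X (Pi.single j (EuclideanSpace.single k (1 : ℝ)))‖₊ : ℝ≥0∞) ^ 2 :=
    fun z j => ((measurable_const.indicator (measurableSet_box ℓ)).comp
      ((measurable_config_apply j).sub_const z)).mul (measurable_kineticDensityAt hψ j)
  have hKsum : ∀ z : Space, (∫⁻ X, ∑ j, (box ℓ).indicator (fun _ => (1 : ℝ≥0∞)) (X j - z) *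
            ∑ k : Fin 3, (‖fderiv ℝ Ψ.ψ X (Pi.single j (EuclideanSpace.single k (1 : ℝ)))‖₊ : ℝ≥0∞) ^ 2) =
      ∑ j, ∫⁻ X, (box ℓ).indicator (fun _ => (1 : ℝ≥0∞)) (X j - z) *
        ∑ k : Fin 3, (‖fderiv ℝ Ψ.ψ X (Pi.single j (EuclideanSpace.single k (1 : ℝ)))‖₊ : ℝ≥0∞) ^ 2 :=
    fun z => lintegral_finsetSum _ fun j _ => hkj z j
  have hvol0 : volume (box ℓ) ≠ 0 := by
    rw [volume_box]; exact pow_ne_zero _ (by rwa [Ne, ENNReal.ofReal_eq_zero, not_le])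
  have htile := lintegral_kineticDensity_eq_tiling hψ (box ℓ) (measurableSet_box ℓ) hvol0
    (volume_box_lt_top ℓ).ne
  rw [volume_box, ← lintegral_congr hKsum] at htile
  have hc0 : (ENNReal.ofReal ℓ ^ 3)⁻¹ ≠ 0 :=
    ENNReal.inv_ne_zero.2 (ENNReal.pow_ne_top ENNReal.ofReal_ne_top)
  have hKtop : ∫⁻ z, ∫⁻ X, ∑ j, (box ℓ).indicator (fun _ => (1 : ℝ≥0∞)) (X j - z) *
            ∑ k : Fin 3, (‖fderiv ℝ Ψ.ψ X (Pi.single j (EuclideanSpace.single k (1 : ℝ)))‖₊ : ℝ≥0∞) ^ 2 ≠ ⊤ := by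
    intro h
    rw [h, ENNReal.mul_top hc0] at htile
    exact hkin htile
  have hTkin : (∫⁻ X, kineticDensity Ψ.ψ X).toReal = (ℓ ^ 3)⁻¹ * (∫⁻ z, ∫⁻ X, ∑ j, (box ℓ).indicator (fun _ => (1 : ℝ≥0∞)) (X j - z) *
            ∑ k : Fin 3, (‖fderiv ℝ Ψ.ψ X (Pi.single j (EuclideanSpace.single k (1 : ℝ)))‖₊ : ℝ≥0∞) ^ 2).toReal := by
    rw [htile, ENNReal.toReal_mul, ENNReal.toReal_inv, ENNReal.toReal_pow, ENNReal.toReal_ofReal hℓ.le]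
  -- the background–background term: at least `2·(½∬w)` on every interior box
  have hBBi : Integrable fun z : Space => ∫ q in box L ×ˢ box L, χ (ℓ⁻¹ • (q.1 - z)) * (Real.exp (-(ω / ℓ * ‖q.1 - q.2‖)) / ‖q.1 - q.2‖) * χ (ℓ⁻¹ • (q.2 - z)) ∂(volume.prod volume) := integrable_sliding_bb_box hθc hθsupp hν L
  have hBBnn : ∀ z : Space, 0 ≤ ∫ q in box L ×ˢ box L, χ (ℓ⁻¹ • (q.1 - z)) * (Real.exp (-(ω / ℓ * ‖q.1 - q.2‖)) / ‖q.1 - q.2‖) * χ (ℓ⁻¹ • (q.2 - z)) ∂(volume.prod volume) := fun z =>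
    setIntegral_nonneg ((measurableSet_box L).prod (measurableSet_box L)) fun q _ =>
      mul_nonneg (mul_nonneg (hθnn _) (hY0 _)) (hθnn _)
  have hBBeq : ∀ z ∈ {z : Space | ∀ k, z k ∈ Set.Icc 0 (L - ℓ)}, ∫ q in box L ×ˢ box L, χ (ℓ⁻¹ • (q.1 - z)) * (Real.exp (-(ω / ℓ * ‖q.1 - q.2‖)) / ‖q.1 - q.2‖) * χ (ℓ⁻¹ • (q.2 - z)) ∂(volume.prod volume) = 2 * boxBackgroundSelfEnergy (fun x => χ (ℓ⁻¹ • x)) (ω / ℓ) := fun z hz =>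
    setIntegral_boxBB_eq hθc hθsupp hθ0 hν hz
  have hZIm : MeasurableSet {z : Space | ∀ k, z k ∈ Set.Icc 0 (L - ℓ)} := measurableSet_zInterior L ℓ
  have hVI : (volume {z : Space | ∀ k, z k ∈ Set.Icc 0 (L - ℓ)}).toReal = (L - ℓ) ^ 3 := by
    rw [volume_zInterior, ENNReal.toReal_pow, ENNReal.toReal_ofReal (sub_nonneg.2 hℓL)]
  have hIBB : 2 * boxBackgroundSelfEnergy (fun x => χ (ℓ⁻¹ • x)) (ω / ℓ) * (L - ℓ) ^ 3 ≤ ∫ z, ∫ q in box L ×ˢ box L, χ (ℓ⁻¹ • (q.1 - z)) * (Real.exp (-(ω / ℓ * ‖q.1 - q.2‖)) / ‖q.1 - q.2‖) * χ (ℓ⁻¹ • (q.2 - z)) ∂(volume.prod volume) := by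
    calc 2 * boxBackgroundSelfEnergy (fun x => χ (ℓ⁻¹ • x)) (ω / ℓ) * (L - ℓ) ^ 3 = ∫ z in {z : Space | ∀ k, z k ∈ Set.Icc 0 (L - ℓ)}, 2 * boxBackgroundSelfEnergy (fun x => χ (ℓ⁻¹ • x)) (ω / ℓ) := by
          rw [setIntegral_const, smul_eq_mul, measureReal_def, hVI, mul_comm]
      _ = ∫ z in {z : Space | ∀ k, z k ∈ Set.Icc 0 (L - ℓ)}, ∫ q in box L ×ˢ box L, χ (ℓ⁻¹ • (q.1 - z)) * (Real.exp (-(ω / ℓ * ‖q.1 - q.2‖)) / ‖q.1 - q.2‖) * χ (ℓ⁻¹ • (q.2 - z)) ∂(volume.prod volume) := (setIntegral_congr_fun hZIm hBBeq).symm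
      _ ≤ ∫ z, ∫ q in box L ×ˢ box L, χ (ℓ⁻¹ • (q.1 - z)) * (Real.exp (-(ω / ℓ * ‖q.1 - q.2‖)) / ‖q.1 - q.2‖) * χ (ℓ⁻¹ • (q.2 - z)) ∂(volume.prod volume) := setIntegral_le_integral hBBi (Eventually.of_forall hBBnn)
  -- pass to real numbers
  have hcN : 0 ≤ q * (∫ u, χ u ^ 2)⁻¹ * ρ * (N * (M * (M * ∫ y, yukawa (ω / ℓ) y))) := by positivity
  have hc2 : 0 ≤ q * (∫ u, χ u ^ 2)⁻¹ * ρ * (N * (M * (M * ∫ y, yukawa (ω / ℓ) y))) - Emin +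
              q * (∫ u, χ u ^ 2)⁻¹ * ρ ^ 2 * boxBackgroundSelfEnergy (fun x => χ (ℓ⁻¹ • x)) (ω / ℓ) := by
    nlinarith [mul_nonneg (mul_nonneg hg (sq_nonneg ρ)) hbb0]
  have hint' : ENNReal.ofReal (q * (∫ u, χ u ^ 2)⁻¹ * ρ * (N * (M * (M * ∫ y, yukawa (ω / ℓ) y)))) * volume {z : Space | ∀ k, z k ∈ Set.Ioo (-ℓ) L} +
      ENNReal.ofReal (q * (∫ u, χ u ^ 2)⁻¹ * ρ) * (∫⁻ z in {z : Space | ∀ k, z k ∈ Set.Ioo (-ℓ) L}, ∫⁻ X, ENNReal.ofReal (∑ j, χ (ℓ⁻¹ • (X j - z)) * smearedBackground (fun x => χ (ℓ⁻¹ • x)) (ω / ℓ) (X j - z)) * (‖Ψ.ψ X‖₊ : ℝ≥0∞) ^ 2) ≤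
      ENNReal.ofReal 1 * (∫⁻ z, ∫⁻ X, ∑ j, (box ℓ).indicator (fun _ => (1 : ℝ≥0∞)) (X j - z) *
            ∑ k : Fin 3, (‖fderiv ℝ Ψ.ψ X (Pi.single j (EuclideanSpace.single k (1 : ℝ)))‖₊ : ℝ≥0∞) ^ 2) +
        ENNReal.ofReal (q * (∫ u, χ u ^ 2)⁻¹) * (∫⁻ z, ∫⁻ X, ENNReal.ofReal (∑ i, ∑ j with i < j, χ (ℓ⁻¹ • (X i - z)) * (Real.exp (-(ω / ℓ * ‖X i - X j‖)) / ‖X i - X j‖) * χ (ℓ⁻¹ • (X j - z))) * (‖Ψ.ψ X‖₊ : ℝ≥0∞) ^ 2) +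
        ENNReal.ofReal (q * (∫ u, χ u ^ 2)⁻¹ * ρ * (N * (M * (M * ∫ y, yukawa (ω / ℓ) y))) - Emin +
              q * (∫ u, χ u ^ 2)⁻¹ * ρ ^ 2 * boxBackgroundSelfEnergy (fun x => χ (ℓ⁻¹ • x)) (ω / ℓ)) * volume {z : Space | ∀ k, z k ∈ Set.Ioo (-ℓ) L} := by
    rw [ENNReal.ofReal_one, one_mul]
    exact hint
  have hreal := toReal_of_ofReal_mul_le hcN (mul_nonneg hg hρ) zero_le_one hg hc2 hVZtop hPBFtop
    hKtop hIPP hint'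
  rw [hVZr] at hreal
  have hPBr := ENNReal.toReal_mono hPBFtop hPBΛle
  -- the final arithmetic (abstract lemma: unification is up to definitional unfolding)
  have hVdiff : 0 ≤ (L + ℓ) ^ 3 - (L - ℓ) ^ 3 := by
    have : (L - ℓ) ^ 3 ≤ (L + ℓ) ^ 3 := pow_le_pow_left₀ (by linarith) (by linarith) 3
    linarith
  exact reduction_arith hq.le hρ hγ0 hℓ3.le hVdiff hγℓ hTkin hslide hreal hPBr hIBB hbbE

/-- **[LiebSolovej2001, Lemma 3.3] (reduction to one small box)**: under the hypotheses of
`chargedEnergy_toReal_ge_boxes`, for `N ≥ 1` (so that trial states exist) the neutral-jellium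
ground-state energy in `Λ_L` satisfies
`E₀(N, L) ≥ ℓ⁻³(L+ℓ)³ Emin - ℓ⁻³ qγρ²(3πM²ℓ⁵)((L+ℓ)³ - (L-ℓ)³) - q ω N/(2ℓ)`,
`E₀(N,L) = (chargedGroundStateEnergy 0 q ρ N L).toReal - jelliumEnergyShift q ρ N L`, with
`Emin ≤ 0` any common lower bound of `inf Spec` of the one-box Hamiltonians
`boxGroundStateEnergy 1 (qγ) ρ χ_ℓ (ω/ℓ) n ℓ`, `n ≤ N` ("in the rest of the paper we shall study
the Hamiltonian (3.9)"). [cite: LiebSolovej2001, Lemma 3.3] -/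
theorem chargedGroundStateEnergy_toReal_ge_boxes (hχ : ContDiff ℝ (⊤ : ℕ∞) χ)
    (hsupp : HasCompactSupport χ) (hχ0 : (∫ u, χ u ^ 2) ≠ 0) (hχnn : ∀ x, 0 ≤ χ x) {M : ℝ}
    (hχM : ∀ x, χ x ≤ M) (hχbox : ∀ x, x ∉ box 1 → χ x = 0) :
    ∃ ω₀ : ℝ, 0 < ω₀ ∧ ∀ ω : ℝ, ω₀ ≤ ω → ∀ ℓ : ℝ, 0 < ℓ → ∀ ρ : ℝ, 0 ≤ ρ → ∀ L : ℝ, ℓ ≤ L →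
      ∀ {q : ℝ}, 0 < q → ∀ {N : ℕ}, 0 < N → ∀ {Emin : ℝ},
        (∀ n, n ≤ N → Emin ≤
          boxGroundStateEnergy 1 (q * (∫ u, χ u ^ 2)⁻¹) ρ (fun x => χ (ℓ⁻¹ • x)) (ω / ℓ) n ℓ) →
        Emin ≤ 0 →
        (ℓ ^ 3)⁻¹ * (L + ℓ) ^ 3 * Emin -
            (ℓ ^ 3)⁻¹ * (q * (∫ u, χ u ^ 2)⁻¹ * ρ ^ 2 * (3 * π * M ^ 2 * ℓ ^ 5)) * ((L + ℓ) ^ 3 - (L - ℓ) ^ 3) -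
            q * (1 / 2 * (ω / ℓ) * N) ≤
          (chargedGroundStateEnergy 0 q ρ N L).toReal - jelliumEnergyShift q ρ N L := by
  obtain ⟨ω₀, hω₀, H⟩ := chargedEnergy_toReal_ge_boxes hχ hsupp hχ0 hχnn hχM hχbox
  refine ⟨ω₀, hω₀, fun ω hω ℓ hℓ ρ hρ L hℓL q hq N hN Emin hEmin hEmin0 => ?_⟩
  have hL : 0 < L := hℓ.trans_le hℓL
  set B : ℝ := (ℓ ^ 3)⁻¹ * (L + ℓ) ^ 3 * Emin -
    (ℓ ^ 3)⁻¹ * (q * (∫ u, χ u ^ 2)⁻¹ * ρ ^ 2 * (3 * π * M ^ 2 * ℓ ^ 5)) * ((L + ℓ) ^ 3 - (L - ℓ) ^ 3) -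
    q * (1 / 2 * (ω / ℓ) * N) with hB
  -- every trial state has energy at least `B + shift`
  have hΨ : ∀ Ψ : TrialState N L, ENNReal.ofReal (B + jelliumEnergyShift q ρ N L) ≤ chargedEnergy 0 q ρ Ψ := by
    intro Ψ
    have h := H ω hω ℓ hℓ ρ hρ L hℓL hq Ψ hEmin hEmin0
    have hfin : chargedEnergy 0 q ρ Ψ ≠ ⊤ := chargedEnergy_ne_top q hρ Ψ
    rw [← ENNReal.ofReal_toReal hfin]
    exact ENNReal.ofReal_le_ofReal (by linarith)
  have hE : ENNReal.ofReal (B + jelliumEnergyShift q ρ N L) ≤ chargedGroundStateEnergy 0 q ρ N L :=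
    le_iInf hΨ
  have hfin : chargedGroundStateEnergy 0 q ρ N L ≠ ⊤ := chargedGroundStateEnergy_ne_top hN hL q hρ
  have h := ENNReal.toReal_mono hfin hE
  rw [ENNReal.toReal_ofReal'] at h
  linarith [le_max_left (B + jelliumEnergyShift q ρ N L) 0]

end Reduction

end Literature.MathematicalPhysics.QuantumManyBody.JelliumBoseGas
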